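import Literature.AnabelianGeometry.EtaleTheta.BiKummerRoots
import Literature.AlgebraicGeometry.Frobenioids.ModelFrobenioidPreSteps

/-!
# [EtTh] Prop 4.3 (i), proof ingredients: divisors of an `N`-th root of a fraction-pair, and the
# lifting of a trivializing automorphism along `s'_N`, `s''_N`

Mochizuki, *The étale theta function …*, Publ. RIMS **45** (2009), §4, proof of Prop. 4.3 (i), PDF p.91
[cite: MochizukiEtTh2009, Prop 4.3 p.91]: "it suffices to prove that `Div(s'_N)`, `Div(s''_N) ∈ Φ(A_N)`
are fixed by `H_{A_N}`.  But since `N · Div(s'_N)`, `N · Div(s''_N) ∈ Φ(A_N)` arise as pull-backs to `A_N`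
of elements of `Φ(A_⊙)` [i.e. `Div(s')`, `Div(s'')`], this follows from the fact that `H_⊙` acts trivially
on `A_⊙^bs` [together with the fact the monoid `Φ(A_N)` is torsion-free!]."  abc-iut cell, layer L2
(seat abc-iut-L6-t12), over abc-iut-L2-t3's `NthRoot` (`BiKummerRoots.lean`), for the model Frobenioid
`C = S.tf.category` ([FrdI] Thm. 5.2):
* `NthRoot.div_num_pow` / `div_den_pow`: `N · Div(s'_N) = α^* Div(s')`, `N · Div(s''_N) = α^* Div(s'')`
  (from the root squares `s' ∘ α = β ∘ s'_N` with `α, β` isometries of Frobenius degree `N`);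
* `NthRoot.existsUnique_aut_comp_num` / `_den`: a trivializing automorphism `τ ∈ Aut_C(A_N)` that fixes
  `Div(s'_N)` lifts UNIQUELY along the pre-step `s'_N` to `σ ∈ Aut_C(B_N)` with `σ ∘ s'_N = s'_N ∘ τ`
  ("the general theory of Frobenioids — the first equivalence of categories involving pre-steps of
  [FrdI] Def. 1.3 (iii)(d); the fact that Frobenioids are always totally epimorphic", p.91) — by the
  landed `ModelFrobenioid.exists_iso_comp_eq_of_div_eq` / `cancel_left_of_isIso_baseMap`;
* `pow_injective_of_isDivisorial`: "`Φ(A_N)` is torsion-free": `x^N = y^N ⇒ x = y` in a divisorial monoid.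
The remaining input of the printed existence proof — that `H_{A_N}` fixes `α^* Div(s')` because `H_⊙`
acts trivially on `A_⊙^bs` — needs the `Π^tp_X`-equivariance of `Base(α)` w.r.t. the surjections
`Π^tp_X ↠ Aut_D(−)` of the Galois objects, which the typed setting does not carry (merge-gated on the
temperoid structure); it is NOT assumed or proved here.  No new definitions.
-/

noncomputable section

namespace Literature.AnabelianGeometry.EtaleTheta

open CategoryTheory Opposite Literature.AlgebraicGeometry.Frobenioids
open Literature.AlgebraicGeometry.Frobenioids.PreFrobenioid (pull_injective)

universe u₀ v₀ u v w

variable {K : Type u₀} [Field K]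

namespace BiKummerSetting

variable {X : SemiGraphs.TemperedArithmeticGroup.{u₀} K} {D₀ : Type u₀} [Category.{v₀} D₀]
  {V : FrdIMonoidStub.{w}} {T : RealifiedDivisorMonoids (D₀ := D₀) V} {D : Type u} [Category.{v} D]
  {VD : FrdICatStub.{u, v, w} D} {S : BiKummerSetting X T D VD}

/-- "`Φ(A_N)` is torsion-free" in the form the proof of Prop. 4.3 (i) uses: in a divisorial (integral,
saturated, sharp) monoid, `x^N = y^N` with `N ≥ 1` forces `x = y` (in `M^gp`, `(x/y)^N = 1`; saturation
puts `x/y` in `M`, where it is a unit, hence `1`). [cite: MochizukiFrdI2008, §0 p.11] -/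
theorem pow_injective_of_isDivisorial {M : Type w} [CommMonoid M] (hM : IsDivisorial M) (N : ℕ+)
    {x y : M} (h : x ^ (N : ℕ) = y ^ (N : ℕ)) : x = y := by
  have hint := hM.isPreDivisorial.isIntegral
  -- `z := of x / of y` satisfies `z ^ N = 1`, hence lies in the image of `M`
  have hz : (Algebra.GrothendieckGroup.of x / Algebra.GrothendieckGroup.of y) ^ (N : ℕ) = 1 := by
    rw [div_pow, ← map_pow, ← map_pow, h, div_self']
  obtain ⟨z, hz'⟩ := hM.isPreDivisorial.isSaturated.1 _ (N : ℕ) N.pos ⟨1, by rw [map_one, hz]⟩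
  -- `z ^ N = 1` in `M`, so `z` is a unit, so `z = 1`
  have hzN : z ^ (N : ℕ) = 1 := hint.injective_of (by rw [map_pow, hz', hz, map_one])
  have hz1 : z = 1 := hM.isSharp.1 _ (IsUnit.of_pow_eq_one hzN N.ne_zero)
  rw [hz1, map_one] at hz'
  exact hint.injective_of (eq_of_div_eq_one hz'.symm)

namespace NthRoot

variable {A B : S.C} {f : S.biratUnits A} {P : S.FractionPair f B} {N : ℕ+}
  {pullFrac : ∀ {A A' : S.C} (_ : A' ⟶ A), S.biratUnits A → S.biratUnits A'}
  (R : S.NthRoot f P N pullFrac)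

/-- **`N · Div(s'_N) = α^* Div(s')`** (proof of Prop. 4.3 (i), p.91: "`N · Div(s'_N)` … arise[s] as
pull-back to `A_N` of … `Div(s')`"): read off the root square `s' ∘ α = β ∘ s'_N`, `α`, `β` isometries,
`deg_Fr(β) = N`, `s'` linear. [cite: MochizukiEtTh2009, Prop 4.3(i) p.91] -/
theorem div_num_pow : ModelFrobenioid.div R.pair.num ^ (N : ℕ) =
    pull S.tf.divisorMonoid (ModelFrobenioid.baseMap R.α) (ModelFrobenioid.div P.num) := by
  have hα : ModelFrobenioid.div R.α = 1 := R.isIsometry.1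
  have hβ : ModelFrobenioid.div R.β = 1 := R.isIsometry.2.1
  have hβN : ModelFrobenioid.degFr R.β = N := R.isIsometry.2.2.2
  have hn1 : ModelFrobenioid.degFr P.num = 1 := P.isPreStep_num.1
  have e := congrArg ModelFrobenioid.div R.comm_num
  rw [ModelFrobenioid.div_comp_pull, ModelFrobenioid.div_comp_pull, hβ, map_one, one_mul, hβN, hα, hn1,
    PNat.one_coe, pow_one, mul_one] at e
  exact e

/-- **`N · Div(s''_N) = α^* Div(s'')`** (proof of Prop. 4.3 (i), p.91), from the root square
`s'' ∘ α = β ∘ s''_N`. [cite: MochizukiEtTh2009, Prop 4.3(i) p.91] -/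
theorem div_den_pow : ModelFrobenioid.div R.pair.den ^ (N : ℕ) =
    pull S.tf.divisorMonoid (ModelFrobenioid.baseMap R.α) (ModelFrobenioid.div P.den) := by
  have hα : ModelFrobenioid.div R.α = 1 := R.isIsometry.1
  have hβ : ModelFrobenioid.div R.β = 1 := R.isIsometry.2.1
  have hβN : ModelFrobenioid.degFr R.β = N := R.isIsometry.2.2.2
  have hd1 : ModelFrobenioid.degFr P.den = 1 := P.isPreStep_den.1
  have e := congrArg ModelFrobenioid.div R.comm_den
  rw [ModelFrobenioid.div_comp_pull, ModelFrobenioid.div_comp_pull, hβ, map_one, one_mul, hβN, hα, hd1,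
    PNat.one_coe, pow_one, mul_one] at e
  exact e

/-- **`Div(s'_N)` is fixed by `τ ∈ Aut_C(A_N)` as soon as `τ` fixes `α^* Div(s')`** ("together with the
fact the monoid `Φ(A_N)` is torsion-free", p.91; `Φ` divisorial). [cite: MochizukiEtTh2009, Prop 4.3(i) p.91] -/
theorem pull_div_num_eq (hΦd : Objectwise (fun M _ => IsDivisorial M) S.tf.divisorMonoid) (τ : Aut R.AN)
    (hτ : pull S.tf.divisorMonoid (ModelFrobenioid.baseMap τ.hom)
        (pull S.tf.divisorMonoid (ModelFrobenioid.baseMap R.α) (ModelFrobenioid.div P.num)) =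
      pull S.tf.divisorMonoid (ModelFrobenioid.baseMap R.α) (ModelFrobenioid.div P.num)) :
    pull S.tf.divisorMonoid (ModelFrobenioid.baseMap τ.hom) (ModelFrobenioid.div R.pair.num) =
      ModelFrobenioid.div R.pair.num := by
  apply pow_injective_of_isDivisorial (hΦd R.AN.base) N
  rw [← map_pow, R.div_num_pow, hτ]

/-- The same for the divisor of poles `Div(s''_N)`. [cite: MochizukiEtTh2009, Prop 4.3(i) p.91] -/
theorem pull_div_den_eq (hΦd : Objectwise (fun M _ => IsDivisorial M) S.tf.divisorMonoid) (τ : Aut R.AN)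
    (hτ : pull S.tf.divisorMonoid (ModelFrobenioid.baseMap τ.hom)
        (pull S.tf.divisorMonoid (ModelFrobenioid.baseMap R.α) (ModelFrobenioid.div P.den)) =
      pull S.tf.divisorMonoid (ModelFrobenioid.baseMap R.α) (ModelFrobenioid.div P.den)) :
    pull S.tf.divisorMonoid (ModelFrobenioid.baseMap τ.hom) (ModelFrobenioid.div R.pair.den) =
      ModelFrobenioid.div R.pair.den := by
  apply pow_injective_of_isDivisorial (hΦd R.AN.base) N
  rw [← map_pow, R.div_den_pow, hτ]

/-- **The lifting step of Prop. 4.3 (i)** ("the first equivalence of categories involving pre-steps of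
[FrdI] Def. 1.3 (iii)(d); the fact that Frobenioids are always totally epimorphic", p.91): an
automorphism `τ` of `A_N` fixing `Div(s'_N)` lifts UNIQUELY along `s'_N` — there is exactly one
`σ ∈ Aut_C(B_N)` with `σ ∘ s'_N = s'_N ∘ τ` (`Φ` divisorial, `B` group-like).
[cite: MochizukiEtTh2009, Prop 4.3(i) p.91] -/
theorem existsUnique_aut_comp_num (hΦd : Objectwise (fun M _ => IsDivisorial M) S.tf.divisorMonoid)
    (hBg : Objectwise (fun M _ => IsGroupLike M) S.tf.ratFnFunctor) (τ : Aut R.AN)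
    (hτ : pull S.tf.divisorMonoid (ModelFrobenioid.baseMap τ.hom) (ModelFrobenioid.div R.pair.num) =
      ModelFrobenioid.div R.pair.num) :
    ∃! σ : Aut R.BN, R.pair.num ≫ σ.hom = τ.hom ≫ R.pair.num := by
  haveI : IsIso (ModelFrobenioid.baseMap R.pair.num) := R.pair.isPreStep_num.2
  haveI : IsIso (ModelFrobenioid.baseMap (τ.hom ≫ R.pair.num)) :=
    (ModelFrobenioid.isPreStep_comp_of_isIso' τ.hom R.pair.isPreStep_num).2
  have hdeg : ModelFrobenioid.degFr R.pair.num = ModelFrobenioid.degFr (τ.hom ≫ R.pair.num) := by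
    rw [ModelFrobenioid.degFr_comp, ModelFrobenioid.degFr_eq_one_of_isIso τ.hom, mul_one]
  have hdiv : ModelFrobenioid.div R.pair.num = ModelFrobenioid.div (τ.hom ≫ R.pair.num) := by
    rw [ModelFrobenioid.div_comp_of_isIso' hΦd τ.hom, hτ]
  obtain ⟨v, hv⟩ := ModelFrobenioid.exists_iso_comp_eq_of_div_eq hBg R.pair.num (τ.hom ≫ R.pair.num) hdeg hdiv
  refine ⟨v, hv, fun σ hσ => ?_⟩
  apply Iso.ext
  exact ModelFrobenioid.cancel_left_of_isIso_baseMap hΦd hBg R.pair.num (hσ.trans hv.symm)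

/-- The lifting step of Prop. 4.3 (i) along the denominator pre-step `s''_N`.
[cite: MochizukiEtTh2009, Prop 4.3(i) p.91] -/
theorem existsUnique_aut_comp_den (hΦd : Objectwise (fun M _ => IsDivisorial M) S.tf.divisorMonoid)
    (hBg : Objectwise (fun M _ => IsGroupLike M) S.tf.ratFnFunctor) (τ : Aut R.AN)
    (hτ : pull S.tf.divisorMonoid (ModelFrobenioid.baseMap τ.hom) (ModelFrobenioid.div R.pair.den) =
      ModelFrobenioid.div R.pair.den) :
    ∃! σ : Aut R.BN, R.pair.den ≫ σ.hom = τ.hom ≫ R.pair.den := by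
  haveI : IsIso (ModelFrobenioid.baseMap R.pair.den) := R.pair.isPreStep_den.2
  haveI : IsIso (ModelFrobenioid.baseMap (τ.hom ≫ R.pair.den)) :=
    (ModelFrobenioid.isPreStep_comp_of_isIso' τ.hom R.pair.isPreStep_den).2
  have hdeg : ModelFrobenioid.degFr R.pair.den = ModelFrobenioid.degFr (τ.hom ≫ R.pair.den) := by
    rw [ModelFrobenioid.degFr_comp, ModelFrobenioid.degFr_eq_one_of_isIso τ.hom, mul_one]
  have hdiv : ModelFrobenioid.div R.pair.den = ModelFrobenioid.div (τ.hom ≫ R.pair.den) := by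
    rw [ModelFrobenioid.div_comp_of_isIso' hΦd τ.hom, hτ]
  obtain ⟨v, hv⟩ := ModelFrobenioid.exists_iso_comp_eq_of_div_eq hBg R.pair.den (τ.hom ≫ R.pair.den) hdeg hdiv
  refine ⟨v, hv, fun σ hσ => ?_⟩
  apply Iso.ext
  exact ModelFrobenioid.cancel_left_of_isIso_baseMap hΦd hBg R.pair.den (hσ.trans hv.symm)

end NthRoot

end BiKummerSetting

end Literature.AnabelianGeometry.EtaleTheta

end
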